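import Mathlib
import HarnessLib
import Literature.Analysis.FluidPDE.SelfSimilar
import Summits.NavierStokesRegularity.NavierStokesRegularity.Theses.AngularGalerkinLadder
import Summits.NavierStokesRegularity.NavierStokesRegularity.Theorems.RungBlowupCofinal.LerayLineRungProfile

/-! # SPLIT KIT for crux K1 `RungBlowupCofinal` along line `leray` (OFFER to the tenure planner g22 — sorry-free,
# NOT a skeleton, NOT registered, NOT landed; cstrat-19959 g0, 2026-08-27)

The crux-strategist protocol's output (b) — a typed DECOMPOSITION of the crux — requires the glue
`Sub₁ → … → Sub_k → RungBlowupCofinal` to be LANDED sorry-free under `Theorems/` and only then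
`ledger route edit route-NavierStokesRegularity-AngularGalerkinLadder --split RungBlowupCofinal --into LerayDoor
LerayApproxProfilesCofinal --glue 'rungBlowupCofinal_of_subs'`. Planner seats do not land `Theorems/` files
(precedent: AdaptedFrequency SplitKit, landed by a prover), so this workfile is the TURNKEY KIT: verbatim the
definitions of `Lines/leray.lean` (v2, commit d689fa7c8506) in a landing namespace, the two sub-crux constants

* `LerayDoor` — the Newton–Kantorovich door in Type-I classes at every fixed rung (= `stub_nk_door`'s statement; L,
  pure analysis, independent of any numerics and of cofinality);
* `LerayApproxProfilesCofinal` — uniformly non-degenerate, non-collapsing approximate steady Leray rung profiles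
  cofinally in `L` (= `stub_nondegenerate_approx_profiles_cofinal`'s statement; XL, the bet);

and the PROVED glue `rungBlowupCofinal_of_subs : LerayDoor → LerayApproxProfilesCofinal → RungBlowupCofinal`
(through circuit g10's landed lift p517517 `AngularGalerkinLadderLerayLine.rungIsSingular_of_lerayProfile`).
Whether K1 should be split at ROUTE level along this line is the tenure planner's decision (the line is registered
either way; a route-level split makes `LerayDoor` a claimable item of its own). Neither piece is the crux reworded:
`LerayDoor` says nothing about existence, `LerayApproxProfilesCofinal` delivers only APPROXIMATE profiles with an
a-priori injectivity constant (the costume probes of the card `Lines/leray.md`, «Probes», all fail). Scope: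
K1-only (objects K2-incapable by p515522). LANDING PATH (tree convention of the landed splits, e.g.
`Theorems/DSolutionBubbleNondegenerateBubbleBridgeSplit.lean`: split files are THEOREMS-ONLY, pieces stated inline over
EXISTING declarations): (i) a `--kind definition` proposal landing this kit's §Definitions verbatim (seven decls:
`lerayResidual`, `IsSteadyLerayRungProfile`, `RungHasLerayProfile`, `lerayLinResidual`, `IsTypeITestField`,
`IsLinearlyStable`, `IsApproxLerayRungProfile`; e.g. as `Summits/NavierStokesRegularity/FluidComputer/AngularGalerkinLadderLerayDoor.lean`,
or wherever the tenure planner's definition item points); (ii) a Theorems-only file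
`Theorems/AngularGalerkinLadderRungBlowupCofinalLeraySplit.lean` with the two pieces INLINE (the bodies of `LerayDoor`,
`LerayApproxProfilesCofinal` below) as hypotheses of `rungBlowupCofinal_of_subs` + this kit's §Glue proofs,
`ledger propose --kind proof … --supports stmt-NavierStokesRegularity-19959` (a prover); (iii)
`ledger route edit … --split RungBlowupCofinal --into LerayDoor LerayApproxProfilesCofinal --glue …` (g22), after which
the gate's `…OfSubs` item is proved by `fun h₁ h₂ => rungBlowupCofinal_of_subs h₁ h₂`. The line `Lines/leray.lean` would
then import (i) instead of carrying its own copies. WHAT THIS IS NOT: not NS; no profile is constructed; nothing moves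
on the ledger by this file; the decision to split is g22's.
-/

noncomputable section

set_option linter.dupNamespace false

namespace Summit.NavierStokesRegularity.AngularGalerkinLadderLeraySplit

open scoped Topology Laplacian ContDiff RealInnerProductSpace
open Filter Set MeasureTheory InnerProductSpace
open Summit.NavierStokesRegularity.FluidComputer
open Literature.Analysis.FluidPDE

local notation "ℝ³" => EuclideanSpace ℝ (Fin 3)

/-! ## The stationary objects -/

/-- **Residual of the truncated backward Leray profile system** (`ν = 1`, `a = ½`, tree `IsLerayProfile` with a force):
`lerayResidual U Q E y = −ΔU(y) + ½U(y) + ½DU(y)·y + (U·∇)U(y) + ∇Q(y) − E(y)`. -/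
noncomputable def lerayResidual (U : ℝ³ → ℝ³) (Q : ℝ³ → ℝ) (E : ℝ³ → ℝ³) (y : ℝ³) : ℝ³ :=
  -(Δ U) y + (1 / 2 : ℝ) • U y + (1 / 2 : ℝ) • fderiv ℝ U y y + convect U U y + gradient Q y - E y

/-- **STEADY LERAY RUNG PROFILE at level `L` with Type-I constant `C`**: a smooth band-limited (degree `≤ L`)
divergence-free profile `U`, a smooth pressure `Q` and a smooth CO-band-limited defect `E` (the Galerkin remainder
`(1 − Π_L)` of the nonlinearity, entering as a force) solving the backward profile system exactly, with the scale-free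
tail bound `‖U(y)‖ ≤ C/(‖y‖ + 1)` (the `t = −1` slice of `HasTypeIDecay C`). -/
def IsSteadyLerayRungProfile (L : ℕ) (C : ℝ) (U : ℝ³ → ℝ³) (Q : ℝ³ → ℝ) (E : ℝ³ → ℝ³) : Prop :=
  AngularLadder.IsBandLimited L U ∧ VectorCalculus.IsDivFree U ∧
    ContDiff ℝ ∞ Q ∧ ContDiff ℝ ∞ E ∧ AngularLadder.IsCobandLimited L E ∧
    (∀ y, lerayResidual U Q E y = 0) ∧
    ∀ y, ‖U y‖ ≤ C / (‖y‖ + 1)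

/-- **Rung `L` carries a non-trivial steady Leray profile** (the stationary strengthening `C⁺_L` of `RungIsSingular L`). -/
def RungHasLerayProfile (L : ℕ) : Prop :=
  ∃ (C : ℝ) (U : ℝ³ → ℝ³) (Q : ℝ³ → ℝ) (E : ℝ³ → ℝ³), IsSteadyLerayRungProfile L C U Q E ∧ ∃ y, U y ≠ 0

/-! ## The Newton–Kantorovich letter -/

/-- **Residual of the LINEARISED profile system at `U₀`** applied to a variation `W` with pressure variation `q` and
defect variation `G`: `−ΔW + ½W + ½DW·y + (U₀·∇)W + (W·∇)U₀ + ∇q − G`. -/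
noncomputable def lerayLinResidual (U₀ W : ℝ³ → ℝ³) (q : ℝ³ → ℝ) (G : ℝ³ → ℝ³) (y : ℝ³) : ℝ³ :=
  -(Δ W) y + (1 / 2 : ℝ) • W y + (1 / 2 : ℝ) • fderiv ℝ W y y + convect U₀ W y + convect W U₀ y +
    gradient q y - G y

/-- **The Type-I test class at level `L`**: smooth band-limited divergence-free fields with the scale-critical weighted
bounds `(1+‖y‖)‖W(y)‖ ≤ B`, `(1+‖y‖)²‖DW(y)‖ ≤ B` for some `B` (the tangent space in which Newton's method runs). -/
def IsTypeITestField (L : ℕ) (W : ℝ³ → ℝ³) : Prop :=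
  AngularLadder.IsBandLimited L W ∧ VectorCalculus.IsDivFree W ∧
    ∃ B : ℝ, ∀ y, (1 + ‖y‖) * ‖W y‖ ≤ B ∧ (1 + ‖y‖) ^ 2 * ‖fderiv ℝ W y‖ ≤ B

/-- **Linear stability (non-degeneracy) of `U₀` at level `L` with constant `K`** — an a-priori INJECTIVITY estimate
for the linearisation MODULO THE GAUGE: for every Type-I test field `W`, every smooth `q` and every smooth
co-band-limited `G`, a `(1+‖y‖)^{5/2}`-weighted sup bound `B` on the linearised residual controls the Type-I norms of
`W` by `K·B` (stated bound-by-bound: no suprema, no function spaces). At an exact or approximate profile this is the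
invertibility of the Fréchet derivative that a radii-polynomial / Newton–Kantorovich certificate verifies. -/
def IsLinearlyStable (L : ℕ) (K : ℝ) (U₀ : ℝ³ → ℝ³) : Prop :=
  ∀ (W : ℝ³ → ℝ³) (q : ℝ³ → ℝ) (G : ℝ³ → ℝ³) (B : ℝ),
    IsTypeITestField L W → ContDiff ℝ ∞ q → ContDiff ℝ ∞ G → AngularLadder.IsCobandLimited L G →
    (∀ y, (1 + ‖y‖) ^ (5 / 2 : ℝ) * ‖lerayLinResidual U₀ W q G y‖ ≤ B) →
    ∀ y, (1 + ‖y‖) * ‖W y‖ + (1 + ‖y‖) ^ 2 * ‖fderiv ℝ W y‖ ≤ K * B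

/-- **APPROXIMATE steady Leray rung profile** at level `L` with stability constant `K`, Type-I constant `C` and
accuracy `η`: a Type-I test field `U₀` with `‖U₀(y)‖ ≤ C/(‖y‖+1)`, a smooth pressure guess `Q₀` and a smooth
co-band-limited defect guess `E₀` whose profile residual is `≤ η (1+‖y‖)^{−5/2}` pointwise, `U₀` being linearly stable
with constant `K`. (What a verified numerical profile IS, as a proposition.) -/
def IsApproxLerayRungProfile (L : ℕ) (K C η : ℝ) (U₀ : ℝ³ → ℝ³) (Q₀ : ℝ³ → ℝ) (E₀ : ℝ³ → ℝ³) : Prop :=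
  IsTypeITestField L U₀ ∧ (∀ y, ‖U₀ y‖ ≤ C / (‖y‖ + 1)) ∧
    ContDiff ℝ ∞ Q₀ ∧ ContDiff ℝ ∞ E₀ ∧ AngularLadder.IsCobandLimited L E₀ ∧
    (∀ y, (1 + ‖y‖) ^ (5 / 2 : ℝ) * ‖lerayResidual U₀ Q₀ E₀ y‖ ≤ η) ∧
    IsLinearlyStable L K U₀

/-! ## Stubs (sorries live ONLY here) -/

/-! ## The two sub-cruxes as named constants -/

/-- **Sub-crux 1 — the Newton–Kantorovich door in Type-I classes at fixed rung** (L, analytic): for every level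
`L`, stability constant `K` and Type-I constant `C` there is an accuracy `η > 0` such that every
`(K, C, η)`-approximate steady Leray rung profile has an EXACT one within `C/4` in the `(1+|y|)`-weighted sup norm.
[idea: cstrat-19959 g0, line leray stub 1] -/
def LerayDoor : Prop :=
  ∀ (L : ℕ) (K C : ℝ), ∃ η > 0, ∀ (U₀ : ℝ³ → ℝ³) (Q₀ : ℝ³ → ℝ) (E₀ : ℝ³ → ℝ³),
    IsApproxLerayRungProfile L K C η U₀ Q₀ E₀ →
      ∃ (C' : ℝ) (U : ℝ³ → ℝ³) (Q : ℝ³ → ℝ) (E : ℝ³ → ℝ³),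
        IsSteadyLerayRungProfile L C' U Q E ∧ ∀ y, (1 + ‖y‖) * ‖U y - U₀ y‖ ≤ C / 4

/-- **Sub-crux 2 — uniformly non-degenerate, non-collapsing approximate profiles cofinally in `L`** (XL, the bet):
for cofinally many rungs there are `K, C > 0` and, for every accuracy `η > 0`, a `(K, C, η)`-approximate steady
Leray rung profile whose weighted amplitude reaches `C/2` somewhere. [idea: cstrat-19959 g0, line leray stub 2] -/
def LerayApproxProfilesCofinal : Prop :=
  ∀ L₀ : ℕ, ∃ L ≥ L₀, ∃ (K C : ℝ), 0 < C ∧ ∀ η > 0,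
    ∃ (U₀ : ℝ³ → ℝ³) (Q₀ : ℝ³ → ℝ) (E₀ : ℝ³ → ℝ³),
      IsApproxLerayRungProfile L K C η U₀ Q₀ E₀ ∧ ∃ y, C / 2 ≤ (1 + ‖y‖) * ‖U₀ y‖

/-! ## Glue (real proofs) -/

/-- **Rung `L` has a steady Leray profile ⇒ rung `L` is singular** — REAL PROOF by the landed bridge
`AngularGalerkinLadderLerayLine.rungIsSingular_of_lerayProfile` (circuit g10, p517517): the lift
`u = lerayBackward ½ 0 U = (−t)^{−1/2}U(x/√−t)`, `p = lerayBackwardPressure ½ 0 Q`, `d = (−t)^{−3/2}E(x/√−t)` is an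
ancient rung-`L` solution, DSS with factor `2` and trivial rotation, Type-I with constant `C`, non-zero at `t = −1`. -/
theorem rungIsSingular_of_rungHasLerayProfile {L : ℕ} (hL : RungHasLerayProfile L) :
    AngularLadder.RungIsSingular L := by
  obtain ⟨C, U, Q, E, ⟨hband, hdiv, hQ, -, hcob, hres, hdec⟩, hnz⟩ := hL
  refine AngularGalerkinLadderLerayLine.rungIsSingular_of_lerayProfile hband.1 hQ (fun y => ?_) hdiv hband hcob
    hdec hnz
  exact sub_eq_zero.mp (hres y)

/-- **The stationary strengthening `C⁺` implies the crux** — hypothesis-free real theorem (the transfer of record):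
`(∀ L₀, ∃ L ≥ L₀, RungHasLerayProfile L) → RungBlowupCofinal`. -/
theorem RungBlowupCofinal_of_lerayProfiles_cofinal (hcof : ∀ L₀ : ℕ, ∃ L ≥ L₀, RungHasLerayProfile L) :
    Summit.NavierStokesRegularity.NavierStokesRegularity.Theses.AngularGalerkinLadder.RungBlowupCofinal := by
  intro L₀
  obtain ⟨L, hL, hP⟩ := hcof L₀
  exact ⟨L, hL, rungIsSingular_of_rungHasLerayProfile hP⟩

/-- **The door opens onto a non-trivial profile** (real proof from stubs 1 and 2 at one rung): an exact profile within
`C/4` of an approximate profile of weighted amplitude `≥ C/2 > 0` is not identically zero. -/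
theorem rungHasLerayProfile_of_door {L : ℕ} {K C : ℝ} (hC : 0 < C)
    (hdoor : ∃ η > 0, ∀ (U₀ : ℝ³ → ℝ³) (Q₀ : ℝ³ → ℝ) (E₀ : ℝ³ → ℝ³),
      IsApproxLerayRungProfile L K C η U₀ Q₀ E₀ →
        ∃ (C' : ℝ) (U : ℝ³ → ℝ³) (Q : ℝ³ → ℝ) (E : ℝ³ → ℝ³),
          IsSteadyLerayRungProfile L C' U Q E ∧ ∀ y, (1 + ‖y‖) * ‖U y - U₀ y‖ ≤ C / 4)
    (happrox : ∀ η > 0, ∃ (U₀ : ℝ³ → ℝ³) (Q₀ : ℝ³ → ℝ) (E₀ : ℝ³ → ℝ³),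
      IsApproxLerayRungProfile L K C η U₀ Q₀ E₀ ∧ ∃ y, C / 2 ≤ (1 + ‖y‖) * ‖U₀ y‖) :
    RungHasLerayProfile L := by
  obtain ⟨η, hη, hd⟩ := hdoor
  obtain ⟨U₀, Q₀, E₀, hA, y₀, hy₀⟩ := happrox η hη
  obtain ⟨C', U, Q, E, hP, hclose⟩ := hd U₀ Q₀ E₀ hA
  refine ⟨C', U, Q, E, hP, y₀, ?_⟩
  intro hU0
  have h1 : (1 + ‖y₀‖) * ‖U y₀ - U₀ y₀‖ ≤ C / 4 := hclose y₀
  rw [hU0, zero_sub, norm_neg] at h1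
  linarith

/-- **THE GLUE of the split**: `LerayDoor → LerayApproxProfilesCofinal → RungBlowupCofinal` — pick a cofinal rung
with non-degenerate approximate profiles, pass the door to an exact non-trivial steady Leray rung profile, lift it
(p517517). -/
theorem rungBlowupCofinal_of_subs (h1 : LerayDoor) (h2 : LerayApproxProfilesCofinal) :
    Summit.NavierStokesRegularity.NavierStokesRegularity.Theses.AngularGalerkinLadder.RungBlowupCofinal := by
  refine RungBlowupCofinal_of_lerayProfiles_cofinal fun L₀ => ?_
  obtain ⟨L, hL, K, C, hC, happrox⟩ := h2 L₀
  exact ⟨L, hL, rungHasLerayProfile_of_door hC (h1 L K C) happrox⟩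

end Summit.NavierStokesRegularity.AngularGalerkinLadderLeraySplit

end
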